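import Summits.BirchSwinnertonDyer.Rank1Residual.X11b.Three.KodairaTransportCoupling
import HarnessLib

/-!
# X11b at `p = 3` (team N8/O2), cross-cell service (o5o6 TARGETS (G4-6)(i)): Tate's algorithm is
# equivariant under UNRAMIFIED local homomorphisms of discrete valuation rings —
# part 3/4: the main theorem over a DVR, `kodairaSymbolOfMinimal (ψ W) = kodairaSymbolOfMinimal W`

HONEST FRAMING (cell `b2b-bsdres`, run/shared/lean/b2b/bsd-rank1-residual/, verbatim in every
file): the goal of the cell is to DELETE the COMBINATION-SHAPED residual classes of the
Birch–Swinnerton-Dyer formula for ALL analytic-rank `≤ 1` elliptic curves over `ℚ` — "full BSD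
formula for every rank `≤ 1` curve in class `C`" assembled STRICTLY from published theorems — so
that the rank-`≤ 1` remainder becomes exactly the CONSTRUCTION-SHAPED classes, which are TYPED
(missing-input `Prop`s), NOT attempted. This is not "finishing BSD". Team N8/O2 = `x11b3`, seat
`b2b-bsdres-x11b3-p4` (lead GEN 7 R8-4 (b), menu (2)). THEOREMS ONLY: no definition, no named
fact, no `sorry`; nothing is booked; no mark / label / count moves.

## What

**`kodairaSymbolOfMinimal_map_of_unif`** — for a local homomorphism `ψ : R₁ →+* R₂` of discrete
valuation rings with PERFECT residue fields and `ψ π₁ = w π₂` (`e = 1`: an unramified extension,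
e.g. the valuation rings `R₀ → R` of the S15 layer, or `𝒪_{K_v} → 𝒪_{L_w}` for `w ∣ v`
unramified), the literal Tate algorithm (Silverman *ATAEC* IV.9.4, steps 1–10) returns the same
Kodaira symbol on `ψ W` as on `W`, for EVERY Weierstrass equation `W` over `R₁` (no minimality,
no `Δ ≠ 0`). The proof is the tree's `kodairaSymbolOfMinimal_map_ringEquiv`
(`TateAlgorithmRingEquivProofs`) VERBATIM with the transport lemmas of parts 1–2 in place of the
isomorphism ones: the two runs are coupled step by step, the rigidity lemmas of
`TateAlgorithmInvarianceProofs` being applied over `R₂`, the divisibility tests transported by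
`pow_dvd_map_iff_of_unif`, `ord Δ` by `addVal_Δ_map_toNat_of_unif`, and the root counts of the
auxiliary polynomials by `distinctRootCount_*_map_of_unif` (through the residue-field embedding
`ψ̄`). Silverman *AEC* Prop. VII.5.4 (a) states the consequence for unramified extensions of local
fields ("the reduction type of `E` over `K` … is the same as … over `K′`"; Tate's algorithm is
the printed proof in the additive case); here the KODAIRA TYPE itself is transported. The local
Tamagawa number `c_v` is NOT claimed invariant (it is not: the components need not be rational).

References (locators only; no new fact): [cite: SilvermanATAEC1994, IV.9.4 (PDF pp. 344–346),
Rem. IV.9.5] [cite: Tate1975, §§7–8] [cite: SilvermanAEC2009, Prop. VII.5.4 (a) (PDF p. 175)].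

## Design

No definitions. Axioms: `propext`, `Classical.choice`, `Quot.sound`.
-/

open Polynomial IsLocalRing

namespace Summit.BirchSwinnertonDyer.Rank1Residual.X11b.Three.KodairaTransport

open Literature.NumberTheory.DiophantineGeometry Literature.NumberTheory.DiophantineGeometry.TateAlgorithm
  WeierstrassCurve

/-! ### The main theorem over a DVR -/

section DVR

variable {R₁ R₂ : Type*} [CommRing R₁] [IsDomain R₁] [IsDiscreteValuationRing R₁]
  [CommRing R₂] [IsDomain R₂] [IsDiscreteValuationRing R₂]

/-- **Tate's algorithm is equivariant under UNRAMIFIED local homomorphisms of DVRs** (perfect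
residue fields): for a local homomorphism `ψ : R₁ →+* R₂` of discrete valuation rings with
`ψ π₁ = w π₂` (`w` a unit) and any Weierstrass equation `W` over `R₁`, the literal implementation `WeierstrassCurve.kodairaSymbolOfMinimal` of steps 1–10 of
Silverman ATAEC IV.9.4 returns the same Kodaira symbol on `ψW` (run over `R₂`, with the
uniformiser `π₂` and the normalising translations chosen over `R₂`) as on `W` (run over `R₁`).
No minimality or `Δ ≠ 0` hypothesis is needed.  Proof: the two runs are coupled step by step as
in `kodairaSymbolOfMinimal_smul`; after each normalisation the `R₂`-model is `Eₖ • ψWₖ` for a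
`u = 1` change `Eₖ` over `R₂` lying in the subgroup singled out by the rigidity lemmas
(`dvd_r_t_of_step2`, `dvd_r_s_t_of_step6/7/7b/8/9`, applied over `R₂`), under which every test
is invariant, while the tests of `ψWₖ` (uniformiser `π₂ = w⁻¹ ψπ₁`) agree with those of `Wₖ`
(`…_map` lemmas: the auxiliary polynomials are twisted coefficientwise by powers of `w̄` and
pushed through `ψ̄ : k₁ → k₂`).  Tate 1975, §§7–8; Silverman ATAEC IV.9.4 and Rem. IV.9.5.
[cite: SilvermanATAEC1994, IV.9.4 (PDF pp. 344–346)] [cite: Tate1975, §§7–8] -/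
theorem kodairaSymbolOfMinimal_map_of_unif [PerfectField (IsLocalRing.ResidueField R₁)]
    [PerfectField (IsLocalRing.ResidueField R₂)] (ψ : R₁ →+* R₂) [IsLocalHom ψ] {w : R₂ˣ}
    (hw : ψ (uniformizer R₁) = ↑w * uniformizer R₂) (W : WeierstrassCurve R₁) :
    (W.map ψ).kodairaSymbolOfMinimal = W.kodairaSymbolOfMinimal := by
  classical
  unfold kodairaSymbolOfMinimal
  simp only []
  -- Step 1
  have i1 : (W.map ψ).Δ ∉ maximalIdeal R₂ ↔ W.Δ ∉ maximalIdeal R₁ := by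
    rw [map_Δ, map_mem_maximalIdeal_iff_of_unif ψ hw]
  by_cases h1 : W.Δ ∉ maximalIdeal R₁
  · rw [if_pos h1, if_pos (i1.mpr h1)]
  rw [if_neg h1, if_neg (fun h => h1 (i1.mp h))]
  have hΔ : W.Δ ∈ maximalIdeal R₁ := not_not.mp h1
  have hΔ' : (W.map ψ).Δ ∈ maximalIdeal R₂ := not_not.mp (fun h => h1 (i1.mp h))
  -- Step 2 normalisations
  have hex2 := exists_variableChange_step2_of_perfectField W hΔ
  have hex2' := exists_variableChange_step2_of_perfectField (W.map ψ) hΔ'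
  have e2 : normalizeStep2 W = hex2.choose • W := by
    unfold normalizeStep2; rw [dif_pos hex2]
  have e2' : normalizeStep2 (W.map ψ) = hex2'.choose • W.map ψ := by
    unfold normalizeStep2; rw [dif_pos hex2']
  rw [e2, e2', addVal_Δ_map_toNat_of_unif ψ hw W]
  obtain ⟨hu2, p3, p4, p6⟩ := hex2.choose_spec
  have n3 := mem_maximalIdeal_iff_dvd.mp p3
  have n4 := mem_maximalIdeal_iff_dvd.mp p4
  have n6 := mem_maximalIdeal_iff_dvd.mp p6
  obtain ⟨hu2', p3', p4', p6'⟩ := hex2'.choose_spec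
  have n3' := mem_maximalIdeal_iff_dvd.mp p3'
  have n4' := mem_maximalIdeal_iff_dvd.mp p4'
  have n6' := mem_maximalIdeal_iff_dvd.mp p6'
  set W₂ := hex2.choose • W with hW₂
  set W₂' := hex2'.choose • W.map ψ with hW₂'
  have hrel₂ : W₂' = (hex2'.choose * 1 * (hex2.choose.map ψ)⁻¹) •
      W₂.map ψ :=
    smul_map_eq_conj_smul_of_unif ψ (one_smul _ _).symm hW₂ hW₂'
  have hu₂ : (hex2'.choose * 1 * (hex2.choose.map ψ)⁻¹).u = 1 :=
    conj_u_eq_one_of_unif ψ hu2' rfl hu2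
  set E₂ := hex2'.choose * 1 * (hex2.choose.map ψ)⁻¹ with hE₂
  clear_value W₂ W₂' E₂
  have v3 : uniformizer R₂ ∣ (W₂.map ψ).a₃ := by
    rw [map_a₃, dvd_map_iff_of_unif ψ hw]; exact n3
  have v4 : uniformizer R₂ ∣ (W₂.map ψ).a₄ := by
    rw [map_a₄, dvd_map_iff_of_unif ψ hw]; exact n4
  have v6 : uniformizer R₂ ∣ (W₂.map ψ).a₆ := by
    rw [map_a₆, dvd_map_iff_of_unif ψ hw]; exact n6
  have m3' : uniformizer R₂ ∣ (E₂ • W₂.map ψ).a₃ := hrel₂ ▸ n3'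
  have m4' : uniformizer R₂ ∣ (E₂ • W₂.map ψ).a₄ := hrel₂ ▸ n4'
  have m6' : uniformizer R₂ ∣ (E₂ • W₂.map ψ).a₆ := hrel₂ ▸ n6'
  obtain ⟨hr₂, ht₂⟩ := dvd_r_t_of_step2 hu₂ v3 v4 v6 m3' m4' m6'
  -- Step 2 test
  have i2 : W₂'.b₂ ∉ maximalIdeal R₂ ↔ W₂.b₂ ∉ maximalIdeal R₁ := by
    rw [mem_maximalIdeal_iff_dvd, mem_maximalIdeal_iff_dvd, hrel₂, dvd_b₂_smul_iff hu₂ hr₂, map_b₂,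
      dvd_map_iff_of_unif ψ hw]
  by_cases h2 : W₂.b₂ ∉ maximalIdeal R₁
  · rw [if_pos h2, if_pos (i2.mpr h2)]
  rw [if_neg h2, if_neg (fun h => h2 (i2.mp h))]
  have hb₂ : uniformizer R₁ ∣ W₂.b₂ := mem_maximalIdeal_iff_dvd.mp (not_not.mp h2)
  have hb₂' : uniformizer R₂ ∣ W₂'.b₂ :=
    mem_maximalIdeal_iff_dvd.mp (not_not.mp (fun h => h2 (i2.mp h)))
  have vb₂ : uniformizer R₂ ∣ (W₂.map ψ).b₂ := by
    rw [map_b₂, dvd_map_iff_of_unif ψ hw]; exact hb₂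
  -- Step 3 test
  have i3 : W₂'.a₆ ∉ maximalIdeal R₂ ^ 2 ↔ W₂.a₆ ∉ maximalIdeal R₁ ^ 2 := by
    rw [mem_maximalIdeal_pow_iff_dvd, mem_maximalIdeal_pow_iff_dvd, hrel₂,
      sq_dvd_a₆_smul_iff hu₂ v3 v4 hr₂ ht₂, map_a₆, pow_dvd_map_iff_of_unif ψ hw]
  by_cases h3 : W₂.a₆ ∉ maximalIdeal R₁ ^ 2
  · rw [if_pos h3, if_pos (i3.mpr h3)]
  rw [if_neg h3, if_neg (fun h => h3 (i3.mp h))]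
  have ha₆ : uniformizer R₁ ^ 2 ∣ W₂.a₆ := mem_maximalIdeal_pow_iff_dvd.mp (not_not.mp h3)
  have ha₆' : uniformizer R₂ ^ 2 ∣ W₂'.a₆ :=
    mem_maximalIdeal_pow_iff_dvd.mp (not_not.mp (fun h => h3 (i3.mp h)))
  have va₆ : uniformizer R₂ ^ 2 ∣ (W₂.map ψ).a₆ := by
    rw [map_a₆, pow_dvd_map_iff_of_unif ψ hw]; exact ha₆
  -- Step 4 test
  have i4 : W₂'.b₈ ∉ maximalIdeal R₂ ^ 3 ↔ W₂.b₈ ∉ maximalIdeal R₁ ^ 3 := by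
    rw [mem_maximalIdeal_pow_iff_dvd, mem_maximalIdeal_pow_iff_dvd, hrel₂,
      cube_dvd_b₈_smul_iff hu₂ v3 v4 va₆ hr₂, map_b₈, pow_dvd_map_iff_of_unif ψ hw]
  by_cases h4 : W₂.b₈ ∉ maximalIdeal R₁ ^ 3
  · rw [if_pos h4, if_pos (i4.mpr h4)]
  rw [if_neg h4, if_neg (fun h => h4 (i4.mp h))]
  have hb₈ : uniformizer R₁ ^ 3 ∣ W₂.b₈ := mem_maximalIdeal_pow_iff_dvd.mp (not_not.mp h4)
  have hb₈' : uniformizer R₂ ^ 3 ∣ W₂'.b₈ :=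
    mem_maximalIdeal_pow_iff_dvd.mp (not_not.mp (fun h => h4 (i4.mp h)))
  have vb₈ : uniformizer R₂ ^ 3 ∣ (W₂.map ψ).b₈ := by
    rw [map_b₈, pow_dvd_map_iff_of_unif ψ hw]; exact hb₈
  -- Step 5 test
  have i5 : W₂'.b₆ ∉ maximalIdeal R₂ ^ 3 ↔ W₂.b₆ ∉ maximalIdeal R₁ ^ 3 := by
    rw [mem_maximalIdeal_pow_iff_dvd, mem_maximalIdeal_pow_iff_dvd, hrel₂,
      cube_dvd_b₆_smul_iff hu₂ v3 va₆ vb₂ vb₈ hr₂, map_b₆, pow_dvd_map_iff_of_unif ψ hw]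
  by_cases h5 : W₂.b₆ ∉ maximalIdeal R₁ ^ 3
  · rw [if_pos h5, if_pos (i5.mpr h5)]
  rw [if_neg h5, if_neg (fun h => h5 (i5.mp h))]
  have hb₆ : uniformizer R₁ ^ 3 ∣ W₂.b₆ := mem_maximalIdeal_pow_iff_dvd.mp (not_not.mp h5)
  have hb₆' : uniformizer R₂ ^ 3 ∣ W₂'.b₆ :=
    mem_maximalIdeal_pow_iff_dvd.mp (not_not.mp (fun h => h5 (i5.mp h)))
  -- Step 6 normalisations
  have hex6 := exists_variableChange_step6_of_dvd n3 n4 ha₆ hb₂ hb₆ hb₈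
  have hex6' := exists_variableChange_step6_of_dvd n3' n4' ha₆' hb₂' hb₆' hb₈'
  have e6 : normalizeStep6 W₂ = hex6.choose • W₂ := by
    unfold normalizeStep6; rw [dif_pos hex6]
  have e6' : normalizeStep6 W₂' = hex6'.choose • W₂' := by
    unfold normalizeStep6; rw [dif_pos hex6']
  rw [e6, e6']
  obtain ⟨hu6, s1, s2, s3, s4, s6⟩ := hex6.choose_spec
  have q1 := mem_maximalIdeal_iff_dvd.mp s1
  have q2 := mem_maximalIdeal_iff_dvd.mp s2
  have q3 := mem_maximalIdeal_pow_iff_dvd.mp s3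
  have q4 := mem_maximalIdeal_pow_iff_dvd.mp s4
  have q6 := mem_maximalIdeal_pow_iff_dvd.mp s6
  obtain ⟨hu6', s1', s2', s3', s4', s6'⟩ := hex6'.choose_spec
  have q1' := mem_maximalIdeal_iff_dvd.mp s1'
  have q2' := mem_maximalIdeal_iff_dvd.mp s2'
  have q3' := mem_maximalIdeal_pow_iff_dvd.mp s3'
  have q4' := mem_maximalIdeal_pow_iff_dvd.mp s4'
  have q6' := mem_maximalIdeal_pow_iff_dvd.mp s6'
  set W₆ := hex6.choose • W₂ with hW₆
  set W₆' := hex6'.choose • W₂' with hW₆'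
  have hrel₆ : W₆' = (hex6'.choose * E₂ * (hex6.choose.map ψ)⁻¹) •
      W₆.map ψ :=
    smul_map_eq_conj_smul_of_unif ψ hrel₂ hW₆ hW₆'
  have hu₆ : (hex6'.choose * E₂ * (hex6.choose.map ψ)⁻¹).u = 1 :=
    conj_u_eq_one_of_unif ψ hu6' hu₂ hu6
  set E₆ := hex6'.choose * E₂ * (hex6.choose.map ψ)⁻¹ with hE₆
  clear_value W₆ W₆' E₆
  have x1 : uniformizer R₂ ∣ (W₆.map ψ).a₁ := by
    rw [map_a₁, dvd_map_iff_of_unif ψ hw]; exact q1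
  have x2 : uniformizer R₂ ∣ (W₆.map ψ).a₂ := by
    rw [map_a₂, dvd_map_iff_of_unif ψ hw]; exact q2
  have x3 : uniformizer R₂ ^ 2 ∣ (W₆.map ψ).a₃ := by
    rw [map_a₃, pow_dvd_map_iff_of_unif ψ hw]; exact q3
  have x4 : uniformizer R₂ ^ 2 ∣ (W₆.map ψ).a₄ := by
    rw [map_a₄, pow_dvd_map_iff_of_unif ψ hw]; exact q4
  have x6 : uniformizer R₂ ^ 3 ∣ (W₆.map ψ).a₆ := by
    rw [map_a₆, pow_dvd_map_iff_of_unif ψ hw]; exact q6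
  have y1' : uniformizer R₂ ∣ (E₆ • W₆.map ψ).a₁ := hrel₆ ▸ q1'
  have y2' : uniformizer R₂ ∣ (E₆ • W₆.map ψ).a₂ := hrel₆ ▸ q2'
  have y3' : uniformizer R₂ ^ 2 ∣ (E₆ • W₆.map ψ).a₃ := hrel₆ ▸ q3'
  have y4' : uniformizer R₂ ^ 2 ∣ (E₆ • W₆.map ψ).a₄ := hrel₆ ▸ q4'
  have y6' : uniformizer R₂ ^ 3 ∣ (E₆ • W₆.map ψ).a₆ := hrel₆ ▸ q6'
  obtain ⟨hr₆, hs₆, ht₆⟩ := dvd_r_s_t_of_step6 hu₆ x1 x2 x3 x4 x6 y1' y2' y3' y4' y6'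
  -- Steps 6 and 7 tests
  have c6 : distinctRootCount (cubicStep6 W₆') = distinctRootCount (cubicStep6 W₆) := by
    rw [hrel₆, distinctRootCount_cubicStep6_smul hu₆ x1 x2 x3 x4 x6 hr₆ hs₆ ht₆,
      distinctRootCount_cubicStep6_map_of_unif ψ hw W₆]
  by_cases h6 : distinctRootCount (cubicStep6 W₆) = 3
  · rw [if_pos h6, if_pos (c6.trans h6)]
  have h6' : distinctRootCount (cubicStep6 W₆') ≠ 3 := fun h => h6 (c6.symm.trans h)
  rw [if_neg h6, if_neg h6']
  by_cases h7 : distinctRootCount (cubicStep6 W₆) = 2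
  · rw [if_pos h7, if_pos (c6.trans h7),
      istarIndex_map_eq_of_unif ψ hw hrel₆ hu₆ q1 q2 q3 q4 q6 q1' q2' q3' q4' q6' h7 (c6.trans h7)]
  have h7' : distinctRootCount (cubicStep6 W₆') ≠ 2 := fun h => h7 (c6.symm.trans h)
  rw [if_neg h7, if_neg h7']
  -- Step 8 normalisations
  have hex8 := exists_variableChange_step8_of_dvd q1 q2 q3 q4 q6 h6 h7
  have hex8' := exists_variableChange_step8_of_dvd q1' q2' q3' q4' q6' h6' h7'
  have e8 : normalizeStep8 W₆ = hex8.choose • W₆ := by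
    unfold normalizeStep8; rw [dif_pos hex8]
  have e8' : normalizeStep8 W₆' = hex8'.choose • W₆' := by
    unfold normalizeStep8; rw [dif_pos hex8']
  rw [e8, e8']
  obtain ⟨hu8, t1, t2, t3, t4, t6⟩ := hex8.choose_spec
  have y1 := mem_maximalIdeal_iff_dvd.mp t1
  have y2 := mem_maximalIdeal_pow_iff_dvd.mp t2
  have y3 := mem_maximalIdeal_pow_iff_dvd.mp t3
  have y4 := mem_maximalIdeal_pow_iff_dvd.mp t4
  have y6 := mem_maximalIdeal_pow_iff_dvd.mp t6
  obtain ⟨hu8', t1', t2', t3', t4', t6'⟩ := hex8'.choose_spec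
  have y1'' := mem_maximalIdeal_iff_dvd.mp t1'
  have y2'' := mem_maximalIdeal_pow_iff_dvd.mp t2'
  have y3'' := mem_maximalIdeal_pow_iff_dvd.mp t3'
  have y4'' := mem_maximalIdeal_pow_iff_dvd.mp t4'
  have y6'' := mem_maximalIdeal_pow_iff_dvd.mp t6'
  set W₈ := hex8.choose • W₆ with hW₈
  set W₈' := hex8'.choose • W₆' with hW₈'
  have hrel₈ : W₈' = (hex8'.choose * E₆ * (hex8.choose.map ψ)⁻¹) •
      W₈.map ψ :=
    smul_map_eq_conj_smul_of_unif ψ hrel₆ hW₈ hW₈'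
  have hu₈ : (hex8'.choose * E₆ * (hex8.choose.map ψ)⁻¹).u = 1 :=
    conj_u_eq_one_of_unif ψ hu8' hu₆ hu8
  set E₈ := hex8'.choose * E₆ * (hex8.choose.map ψ)⁻¹ with hE₈
  clear_value W₈ W₈' E₈
  have hd12 : uniformizer R₂ ∣ uniformizer R₂ ^ 2 := dvd_pow_self _ two_ne_zero
  have z1 : uniformizer R₂ ∣ (W₈.map ψ).a₁ := by
    rw [map_a₁, dvd_map_iff_of_unif ψ hw]; exact y1
  have z2 : uniformizer R₂ ^ 2 ∣ (W₈.map ψ).a₂ := by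
    rw [map_a₂, pow_dvd_map_iff_of_unif ψ hw]; exact y2
  have z3 : uniformizer R₂ ^ 2 ∣ (W₈.map ψ).a₃ := by
    rw [map_a₃, pow_dvd_map_iff_of_unif ψ hw]; exact y3
  have z4 : uniformizer R₂ ^ 3 ∣ (W₈.map ψ).a₄ := by
    rw [map_a₄, pow_dvd_map_iff_of_unif ψ hw]; exact y4
  have z6 : uniformizer R₂ ^ 4 ∣ (W₈.map ψ).a₆ := by
    rw [map_a₆, pow_dvd_map_iff_of_unif ψ hw]; exact y6
  have z1' : uniformizer R₂ ∣ (E₈ • W₈.map ψ).a₁ := hrel₈ ▸ y1''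
  have z2' : uniformizer R₂ ^ 2 ∣ (E₈ • W₈.map ψ).a₂ := hrel₈ ▸ y2''
  have z3' : uniformizer R₂ ^ 2 ∣ (E₈ • W₈.map ψ).a₃ := hrel₈ ▸ y3''
  have z4' : uniformizer R₂ ^ 3 ∣ (E₈ • W₈.map ψ).a₄ := hrel₈ ▸ y4''
  have z6' : uniformizer R₂ ^ 4 ∣ (E₈ • W₈.map ψ).a₆ := hrel₈ ▸ y6''
  obtain ⟨hr₈, hs₈, ht₈⟩ := dvd_r_s_t_of_step8 hu₈ z1 z2 z3 z4 z6 z1' z2' z3' z4' z6'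
  -- Step 8 test
  have c8 : distinctRootCount (quadraticStep8 W₈') = distinctRootCount (quadraticStep8 W₈) := by
    rw [hrel₈, distinctRootCount_quadraticStep8_smul hu₈ z1 (hd12.trans z2) z3 z4 z6 hr₈ hs₈ ht₈,
      distinctRootCount_quadraticStep8_map_of_unif ψ hw W₈]
  by_cases h8 : distinctRootCount (quadraticStep8 W₈) = 2
  · rw [if_pos h8, if_pos (c8.trans h8)]
  have h8' : distinctRootCount (quadraticStep8 W₈') ≠ 2 := fun h => h8 (c8.symm.trans h)
  rw [if_neg h8, if_neg h8']
  -- Step 9 normalisations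
  have hex9 := exists_variableChange_step9_of_dvd y1 y2 y3 y4 y6 h8
  have hex9' := exists_variableChange_step9_of_dvd y1'' y2'' y3'' y4'' y6'' h8'
  have e9 : normalizeStep9 W₈ = hex9.choose • W₈ := by
    unfold normalizeStep9; rw [dif_pos hex9]
  have e9' : normalizeStep9 W₈' = hex9'.choose • W₈' := by
    unfold normalizeStep9; rw [dif_pos hex9']
  rw [e9, e9']
  obtain ⟨hu9, o1, o2, o3, o4, o6⟩ := hex9.choose_spec
  have g1 := mem_maximalIdeal_iff_dvd.mp o1
  have g2 := mem_maximalIdeal_pow_iff_dvd.mp o2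
  have g3 := mem_maximalIdeal_pow_iff_dvd.mp o3
  have g4 := mem_maximalIdeal_pow_iff_dvd.mp o4
  have g6 := mem_maximalIdeal_pow_iff_dvd.mp o6
  obtain ⟨hu9', o1', o2', o3', o4', o6'⟩ := hex9'.choose_spec
  have g1' := mem_maximalIdeal_iff_dvd.mp o1'
  have g2' := mem_maximalIdeal_pow_iff_dvd.mp o2'
  have g3' := mem_maximalIdeal_pow_iff_dvd.mp o3'
  have g4' := mem_maximalIdeal_pow_iff_dvd.mp o4'
  have g6' := mem_maximalIdeal_pow_iff_dvd.mp o6'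
  set W₉ := hex9.choose • W₈ with hW₉
  set W₉' := hex9'.choose • W₈' with hW₉'
  have hrel₉ : W₉' = (hex9'.choose * E₈ * (hex9.choose.map ψ)⁻¹) •
      W₉.map ψ :=
    smul_map_eq_conj_smul_of_unif ψ hrel₈ hW₉ hW₉'
  have hu₉ : (hex9'.choose * E₈ * (hex9.choose.map ψ)⁻¹).u = 1 :=
    conj_u_eq_one_of_unif ψ hu9' hu₈ hu9
  set E₉ := hex9'.choose * E₈ * (hex9.choose.map ψ)⁻¹ with hE₉
  clear_value W₉ W₉' E₉
  have f1 : uniformizer R₂ ∣ (W₉.map ψ).a₁ := by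
    rw [map_a₁, dvd_map_iff_of_unif ψ hw]; exact g1
  have f2 : uniformizer R₂ ^ 2 ∣ (W₉.map ψ).a₂ := by
    rw [map_a₂, pow_dvd_map_iff_of_unif ψ hw]; exact g2
  have f3 : uniformizer R₂ ^ 3 ∣ (W₉.map ψ).a₃ := by
    rw [map_a₃, pow_dvd_map_iff_of_unif ψ hw]; exact g3
  have f4 : uniformizer R₂ ^ 3 ∣ (W₉.map ψ).a₄ := by
    rw [map_a₄, pow_dvd_map_iff_of_unif ψ hw]; exact g4
  have f6 : uniformizer R₂ ^ 5 ∣ (W₉.map ψ).a₆ := by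
    rw [map_a₆, pow_dvd_map_iff_of_unif ψ hw]; exact g6
  have f1' : uniformizer R₂ ∣ (E₉ • W₉.map ψ).a₁ := hrel₉ ▸ g1'
  have f2' : uniformizer R₂ ^ 2 ∣ (E₉ • W₉.map ψ).a₂ := hrel₉ ▸ g2'
  have f3' : uniformizer R₂ ^ 3 ∣ (E₉ • W₉.map ψ).a₃ := hrel₉ ▸ g3'
  have f4' : uniformizer R₂ ^ 3 ∣ (E₉ • W₉.map ψ).a₄ := hrel₉ ▸ g4'
  have f6' : uniformizer R₂ ^ 5 ∣ (E₉ • W₉.map ψ).a₆ := hrel₉ ▸ g6'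
  obtain ⟨hr₉, hs₉, ht₉⟩ := dvd_r_s_t_of_step9 hu₉ f1 f2 f3 f4 f6 f1' f2' f3' f4' f6'
  -- Step 9 test
  have i9 : W₉'.a₄ ∉ maximalIdeal R₂ ^ 4 ↔ W₉.a₄ ∉ maximalIdeal R₁ ^ 4 := by
    rw [mem_maximalIdeal_pow_iff_dvd, mem_maximalIdeal_pow_iff_dvd, hrel₉,
      pow_four_dvd_a₄_smul_iff hu₉ f1 f2 f3 hr₉ hs₉ ht₉, map_a₄, pow_dvd_map_iff_of_unif ψ hw]
  by_cases h9 : W₉.a₄ ∉ maximalIdeal R₁ ^ 4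
  · rw [if_pos h9, if_pos (i9.mpr h9)]
  rw [if_neg h9, if_neg (fun h => h9 (i9.mp h))]
  have ha₄ : uniformizer R₁ ^ 4 ∣ W₉.a₄ := mem_maximalIdeal_pow_iff_dvd.mp (not_not.mp h9)
  have fa₄ : uniformizer R₂ ^ 4 ∣ (W₉.map ψ).a₄ := by
    rw [map_a₄, pow_dvd_map_iff_of_unif ψ hw]; exact ha₄
  -- Step 10 test
  have i10 : W₉'.a₆ ∉ maximalIdeal R₂ ^ 6 ↔ W₉.a₆ ∉ maximalIdeal R₁ ^ 6 := by
    rw [mem_maximalIdeal_pow_iff_dvd, mem_maximalIdeal_pow_iff_dvd, hrel₉,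
      pow_six_dvd_a₆_smul_iff hu₉ f1 f2 f3 fa₄ hr₉ ht₉, map_a₆, pow_dvd_map_iff_of_unif ψ hw]
  by_cases h10 : W₉.a₆ ∉ maximalIdeal R₁ ^ 6
  · rw [if_pos h10, if_pos (i10.mpr h10)]
  rw [if_neg h10, if_neg (fun h => h10 (i10.mp h))]

end DVR

end Summit.BirchSwinnertonDyer.Rank1Residual.X11b.Three.KodairaTransport
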